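import Mathlib
import Summits.Ventures.HodgeRepro.Tier4.Target
import Summits.Ventures.HodgeRepro.Tier4.Line3.Defs

/-!
# Tier4/Line3/BallCoordLemmas — additivity of the ball coordinates and the independence criterion (Skeleton v0.21+)

Blind re-derivation cell `pub-hodge-repro`, Tier 4 «PROVE THE STEP» (README §9–§10), LINE L3, seat t4-x2 (reserve
wall-breaker on L3.4).  The four PROVED support theorems the planner added in v0.21 (S12470, for the displayed
symmetric-tuple hypotheses `h02 h13 hab` of L3.4 / L3.5) — Skeleton v0.24 (FILED 16ccda11d70dc1fc · 1290, S12532)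
L543–L588 VERBATIM, on the tree's `Defs` (p665164): `ballCoord_add`, `ballCoord_smul`, `ballCoord_zero` and
`linearIndependent_of_ballWedge` (two vectors whose ball coordinates have independent first two entries are linearly
independent over `E′` — the bridge from the ball-wedge hypothesis `hab` to the Witt hypothesis of `witt_symm_of_gram`).
The tree's `DefsLemmas` (p666170, v0.14) predates them.  Nothing here asserts anything about the truth of (P); HC_CM is
NOT proved by anyone in this repository.
-/

set_option autoImplicit false

noncomputable section

namespace Summit.Ventures.HodgeRepro.Tier4.Line3

open Matrix

namespace T4Data

variable (X : T4Data)

/-- The ball coordinates are additive. -/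
theorem ballCoord_add (x y : Fin 3 → X.E) : X.ballCoord (x + y) = X.ballCoord x + X.ballCoord y := by
  unfold ballCoord
  rw [← Matrix.mulVec_add]
  congr 1
  ext i
  simp [map_add]

/-- The ball coordinates are `E′`-homogeneous through `τ₀`. -/
theorem ballCoord_smul (s : X.E) (x : Fin 3 → X.E) : X.ballCoord (s • x) = X.τ₀ s • X.ballCoord x := by
  unfold ballCoord
  rw [← Matrix.mulVec_smul]
  congr 1
  ext i
  simp [map_mul]

/-- The ball coordinates of `0` are `0`. -/
theorem ballCoord_zero : X.ballCoord 0 = 0 := by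
  unfold ballCoord
  have : (fun i => X.τ₀ ((0 : Fin 3 → X.E) i)) = (0 : Fin 3 → ℂ) := by ext i; simp
  rw [this, Matrix.mulVec_zero]

/-- Two vectors whose ball coordinates have independent first two entries are linearly independent over `E`
(the support lemma for the symmetric rank-2 hypotheses of L3.4 / L3.5, v0.21). -/
theorem linearIndependent_of_ballWedge {a b : Fin 3 → X.E}
    (hab : X.ballCoord a 0 * X.ballCoord b 1 - X.ballCoord a 1 * X.ballCoord b 0 ≠ 0) :
    LinearIndependent X.E ![a, b] := by
  rw [LinearIndependent.pair_iff]
  intro s t hst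
  have h := congrArg X.ballCoord hst
  rw [ballCoord_add, ballCoord_smul, ballCoord_smul, ballCoord_zero] at h
  have h0 := congrFun h 0
  have h1 := congrFun h 1
  simp only [Pi.add_apply, Pi.smul_apply, smul_eq_mul, Pi.zero_apply] at h0 h1
  have hs : X.τ₀ s = 0 := by
    have : X.τ₀ s * (X.ballCoord a 0 * X.ballCoord b 1 - X.ballCoord a 1 * X.ballCoord b 0) = 0 := by
      linear_combination X.ballCoord b 1 * h0 - X.ballCoord b 0 * h1
    exact (mul_eq_zero.mp this).resolve_right hab
  have ht : X.τ₀ t = 0 := by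
    have : X.τ₀ t * (X.ballCoord a 0 * X.ballCoord b 1 - X.ballCoord a 1 * X.ballCoord b 0) = 0 := by
      linear_combination X.ballCoord a 0 * h1 - X.ballCoord a 1 * h0
    exact (mul_eq_zero.mp this).resolve_right hab
  exact ⟨(map_eq_zero X.τ₀).mp hs, (map_eq_zero X.τ₀).mp ht⟩

end T4Data

end Summit.Ventures.HodgeRepro.Tier4.Line3

end
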